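import Literature.Analysis.FluidPDE.CheskidovPeriodisation
import Literature.Analysis.FluidPDE.CheskidovTotalDissipationProofs
import Literature.Analysis.FluidPDE.PassiveScalarWellPosednessProofs
import Literature.Analysis.FluidPDE.QuasiSelfSimilarFamilyProofs
import Literature.Analysis.FluidPDE.QuasiSelfSimilarCompatibleBlocksProofs
import Literature.Analysis.FluidPDE.QuasiSelfSimilarMixingProofs
import Literature.Analysis.FunctionSpaces.TorusLerayHelmholtzSpaceTime
import HarnessLib

/-!
# Cheskidov's time-periodic dissipation anomaly from the Alberti–Crippa–Mazzucato blocks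
(arXiv:2311.04182, Thm. 1.3 from Thm. 3.1)

Topic `Literature/Analysis/FluidPDE`. Theorem-only assembly file for the vendored **turb.S12**
fact `Literature.Analysis.FluidPDE.cheskidov_time_periodic_anomaly` (`ZerothLaw.lean`;
Cheskidov 2023, Thm. 1.3, solenoidally normalised forces, `ℓ = 1`). The printed proof has three
inputs, and the tree now proves the theorem from the first alone:

1. the quasi-self-similar mixing family of Alberti–Crippa–Mazzucato (Cheskidov 2023, Thm. 3.1 =
   Bruè–De Lellis 2023, Thm. 4.1) — the named facts
   `Literature.Analysis.FluidPDE.alberti_crippa_mazzucato_quasi_self_similar` (item (c) of BDL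
   Thm. 4.1 read with one compact `K` for all levels) and
   `Literature.Analysis.FluidPDE.alberti_crippa_mazzucato_family` (item (c) per level, the
   consistent reading; `QuasiSelfSimilarMixing.lean`), NOT discharged: the per-level family is
   proved in the tree from its geometric heart, the structural named fact `acm_building_blocks`
   (ACM 2019, §8; `QuasiSelfSimilarBuildingBlocks.lean`), by
   `alberti_crippa_mazzucato_family_of_building_blocks` (`QuasiSelfSimilarFamilyProofs.lean`);
2. classical parabolic well-posedness of the advection–diffusion equation (4.2) on `T²`
   ("let `θ^m` be the unique smooth solution of (4.2)") — DISCHARGED,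
   `Torus.exists_unique_isClassicalScalarTransportForcedOn_holds`
   (`PassiveScalarWellPosednessProofs.lean`);
3. the smooth space–time Leray–Helmholtz decomposition on `T²`, which moves the gradient part
   of the drift force `∂ₜv + (v·∇)v - νΔv` into the pressure (the solenoidal normalisation of
   the force in the target statement) — DISCHARGED, `Torus.smooth_leray_helmholtz_holds`
   (`FunctionSpaces/TorusLerayHelmholtzSpaceTime.lean`).

The §§3–4 construction (glued drifts, forces, viscous scalars with total dissipation at `t = 1`)
is `cheskidov_total_dissipation_family_of_acm_family` / `_of_acm`
(`CheskidovTotalDissipationProofs.lean`, from 1 and 2), and the §6 periodisation/assembly is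
`cheskidov_time_periodic_anomaly_of_family` (`CheskidovPeriodisation.lean`, from that family and
3). Composing them: `cheskidov_time_periodic_anomaly_of_acm` (uniform reading),
`cheskidov_time_periodic_anomaly_of_acm_family` (per-level reading), down to the structural
leaf `cheskidov_time_periodic_anomaly_of_acm_building_blocks`, and down to the current kinematic
leaf `cheskidov_time_periodic_anomaly_of_compatible_blocks` (the named fact
`acm_compatible_blocks`, `QuasiSelfSimilarCompatibleBlocks.lean`: the two generating moves of the
Peano snake with their gate structure, ACM 2019, §8.1 and §8.4; the patching, the labels and the
gluing of ACM §6.2/§8.6–8.8 are proved in `QuasiSelfSimilarCompatibleBlocksProofs.lean`). What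
remains for `cheskidov_time_periodic_anomaly_holds` is exactly the discharge of that leaf, i.e.
two smooth time-dependent curves with ACM §8.1 (a)–(e) — equivalently §8.3 (b), (c'), (c''), (d'),
(e); note the equal-area condition (d'): each generating channel splits its square into two
components of area `1/2` at every time, a constraint forced by incompressibility and tangency
(the complement of the channel has two components whose areas are conserved) — which the source
gives by Figures 7–9 only (§8.9–8.11).

The same leaf is also reached through the planar rendering of the mixing family: the named fact
`alberti_crippa_mazzucato_planar_family` (`QuasiSelfSimilarPlanar.lean`; Bruè–De Lellis 2023,
Thm. 4.1 on the unit square of the plane, the form in which the discharge of the leaf is being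
assembled, cf. `alberti_crippa_mazzucato_planar_family_of_compatible_blocks`) gives the per-level
torus family by `alberti_crippa_mazzucato_family_of_planar'` (`QuasiSelfSimilarMixingProofs.lean`,
slice-wise periodisation, BDL §5), whence `cheskidov_time_periodic_anomaly_of_planar_family`.
So `cheskidov_time_periodic_anomaly_holds` is one line from ANY of
`acm_compatible_blocks`, `acm_building_blocks`, `alberti_crippa_mazzucato_planar_family`,
`alberti_crippa_mazzucato_family`, `alberti_crippa_mazzucato_quasi_self_similar`.

## References

* A. Cheskidov, *Dissipation anomaly and anomalous dissipation in incompressible fluid flows*,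
  arXiv:2311.04182 (2023), Thm. 1.3 (p. 5), Thm. 3.1 (p. 10), §4 (4.2), §6 (pp. 18–19).
* E. Bruè, C. De Lellis, *Anomalous dissipation for the forced 3D Navier–Stokes equations*,
  Comm. Math. Phys. 400 (2023), Thm. 4.1.
-/

noncomputable section

namespace Literature.Analysis.FluidPDE

/-- **turb.S12 from the per-level Alberti–Crippa–Mazzucato family.** Cheskidov's time-periodic
dissipation anomaly (`cheskidov_time_periodic_anomaly`, arXiv:2311.04182, Thm. 1.3) follows from
the single named fact `alberti_crippa_mazzucato_family` (Cheskidov 2023, Thm. 3.1 = Bruè–De Lellis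
2023, Thm. 4.1 with item (c) read per level, the consistent reading; see
`QuasiSelfSimilarMixing.lean`): the total-dissipation family of §§3–4 is the per-level form
`cheskidov_total_dissipation_family_of_acm_family` (`CheskidovTotalDissipationProofs`) fed with
the proved parabolic well-posedness `Torus.exists_unique_isClassicalScalarTransportForcedOn_holds`,
the solenoidal normalisation of the force in §6 uses `Torus.smooth_leray_helmholtz_holds`, and the
§6 periodisation is `cheskidov_time_periodic_anomaly_of_family`. [cite: Cheskidov2023, Thm. 1.3, Thm. 3.1 and §6] -/
theorem cheskidov_time_periodic_anomaly_of_acm_family (h : alberti_crippa_mazzucato_family) :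
    cheskidov_time_periodic_anomaly :=
  cheskidov_time_periodic_anomaly_of_family
    (cheskidov_total_dissipation_family_of_acm_family h
      Torus.exists_unique_isClassicalScalarTransportForcedOn_holds)
    (FunctionSpaces.Torus.smooth_leray_helmholtz_holds (Fin 2))

/-- **Deprecated** (2026-08-16) with its hypothesis, the mis-stated `n`-uniform-support rendering
`alberti_crippa_mazzucato_quasi_self_similar` of the mixing family (Bruè–De Lellis 2023,
Thm. 4.1 (c) with one compact set for all levels; deprecated in `QuasiSelfSimilarMixing.lean`):
use `cheskidov_time_periodic_anomaly_of_acm_family` (per-level family, the consistent reading).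
*Content (unchanged):* turb.S12, Cheskidov's time-periodic dissipation anomaly
(`cheskidov_time_periodic_anomaly`, arXiv:2311.04182, Thm. 1.3), from that single named fact
(Cheskidov 2023, Thm. 3.1 = Bruè–De Lellis 2023, Thm. 4.1): the two other inputs of the printed
proof are discharged in the tree — the total-dissipation family of §§3–4 is
`cheskidov_total_dissipation_family_of_acm` (`CheskidovTotalDissipationProofs`) fed with the
proved parabolic well-posedness `Torus.exists_unique_isClassicalScalarTransportForcedOn_holds`
(`PassiveScalarWellPosednessProofs`, the sentence "let `θ^m` be the unique smooth solution of
(4.2)"), and the smooth space–time Leray–Helmholtz decomposition used for the solenoidal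
normalisation of the force in §6 is `Torus.smooth_leray_helmholtz_holds`
(`TorusLerayHelmholtzSpaceTime`); the §6 periodisation is
`cheskidov_time_periodic_anomaly_of_family`. [cite: Cheskidov2023, Thm. 1.3, Thm. 3.1 and §6] -/
@[deprecated cheskidov_time_periodic_anomaly_of_acm_family (since := "2026-08-16")]
theorem cheskidov_time_periodic_anomaly_of_acm (h : alberti_crippa_mazzucato_quasi_self_similar) :
    cheskidov_time_periodic_anomaly :=
  cheskidov_time_periodic_anomaly_of_family
    (cheskidov_total_dissipation_family_of_acm h
      Torus.exists_unique_isClassicalScalarTransportForcedOn_holds)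
    (FunctionSpaces.Torus.smooth_leray_helmholtz_holds (Fin 2))

/-- **turb.S12 from the structural building-block fact alone.** Cheskidov's time-periodic
dissipation anomaly follows from `acm_building_blocks` (the existence of finitely many
Alberti–Crippa–Mazzucato building blocks patching smoothly with handover; ACM 2019, §8, as used
in Bruè–De Lellis 2023, §4.1 and Thm. 4.1): the scaling analysis
`alberti_crippa_mazzucato_family_of_building_blocks` (`QuasiSelfSimilarFamilyProofs`) gives the
per-level family, and `cheskidov_time_periodic_anomaly_of_acm_family` concludes. This is the
whole printed proof of Cheskidov 2023, Thm. 1.3 formalised down to its geometric leaf. [cite: Cheskidov2023, Thm. 1.3, Thm. 3.1 and §6] -/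
theorem cheskidov_time_periodic_anomaly_of_acm_building_blocks (h : acm_building_blocks) :
    cheskidov_time_periodic_anomaly :=
  cheskidov_time_periodic_anomaly_of_acm_family (alberti_crippa_mazzucato_family_of_building_blocks h)

/-- **turb.S12 from the compatible blocks of the Peano snake.** Cheskidov's time-periodic
dissipation anomaly follows from `acm_compatible_blocks` (Alberti–Crippa–Mazzucato 2019, §8.1,
§8.4 (a)–(c), §8.6: finitely many smooth incompressible moves of channels in the unit square,
self-similar at `t = 1` through a gate-consistent child map, agreeing with standard gate fields
near their gates): `acm_building_blocks_of_compatible_blocks`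
(`QuasiSelfSimilarCompatibleBlocksProofs`, the quasi-self-similar induction of ACM §6.2 and the
gluing of §8.6–8.8) gives the structural fact, and
`cheskidov_time_periodic_anomaly_of_acm_building_blocks` concludes. [cite: Cheskidov2023, Thm. 1.3, Thm. 3.1 and §6] -/
theorem cheskidov_time_periodic_anomaly_of_compatible_blocks (h : acm_compatible_blocks) :
    cheskidov_time_periodic_anomaly :=
  cheskidov_time_periodic_anomaly_of_acm_building_blocks (acm_building_blocks_of_compatible_blocks h)

/-- **turb.S12 from the planar Alberti–Crippa–Mazzucato family.** Cheskidov's time-periodic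
dissipation anomaly follows from `alberti_crippa_mazzucato_planar_family` (Bruè–De Lellis 2023,
Thm. 4.1 in its native planar setting on `[0,1] × ℝ²`, `QuasiSelfSimilarPlanar.lean`): the
slice-wise periodisation `alberti_crippa_mazzucato_family_of_planar'`
(`QuasiSelfSimilarMixingProofs`, BDL §5, first paragraph, with the discharged cell-average
estimate) gives the per-level torus family, and `cheskidov_time_periodic_anomaly_of_acm_family`
concludes. [cite: Cheskidov2023, Thm. 1.3, Thm. 3.1 and §6] -/
theorem cheskidov_time_periodic_anomaly_of_planar_family
    (h : alberti_crippa_mazzucato_planar_family) : cheskidov_time_periodic_anomaly :=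
  cheskidov_time_periodic_anomaly_of_acm_family (alberti_crippa_mazzucato_family_of_planar' h)

end Literature.Analysis.FluidPDE

end
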